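import Mathlib.Analysis.SpecialFunctions.Integrals.Basic
import Mathlib.Analysis.SpecialFunctions.Trigonometric.Deriv
import Mathlib.Analysis.Complex.Exponential
import Mathlib.MeasureTheory.Integral.IntervalIntegral.FundThmCalculus
import HarnessLib

/-!
# A Fejér-weighted mean-value LOWER bound for generalized Dirichlet polynomials

Topic `Literature/NumberTheory/LFunctions`. Everything in this file is PROVED (no named facts).

For a finite generalized Dirichlet polynomial `D(t) = ∑_{n ∈ s} a_n e^{−iλ_n t}` with arbitrary
real frequencies `λ_n` (no spacing hypothesis) and NON-NEGATIVE real coefficients `a_n`,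

  `∫₀^L (1 − t/L) |D(t)|² dt = ∑_{m,n} a_m a_n k_L(λ_m − λ_n) ≥ (L/2) ∑_n a_n²`   (`L > 0`),

where `k_L(x) = ∫₀^L (1 − t/L) cos(tx) dt = (1 − cos Lx)/(Lx²) ≥ 0` (`x ≠ 0`), `k_L(0) = L/2`
(`fejerWeightCos`): the Fejér (triangle) weight makes EVERY off-diagonal term non-negative, so the
diagonal alone is a lower bound (`fejer_meanSquare_ge`). This is the mean-value input for
Hilberdink-type arguments on Beurling zeta functions (Hilberdink, JNT 112 (2005), proof of Thm. 1;
JNT 122 (2007), (3)), where the "integers" `e^{λ_n}` may lie arbitrarily close together, so that the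
Montgomery–Vaughan mean value theorem (tree: `DirichletPolynomialMeanValue.lean`, integer
frequencies / spacing) is not available; Hilberdink sums `∫₀^{2r−1}` over `r ≤ R`, which is the
same triangle weight in discrete form.

## References
* [Hilberdink2007] T. W. Hilberdink, *A lower bound for the Lindelöf function associated to
  generalized integers*, J. Number Theory 122 (2007) 336–341, (3) (read).
* [MontgomeryVaughan2007] H. L. Montgomery, R. C. Vaughan, *Multiplicative Number Theory I*, §5.1
  (Cesàro/Fejér weights) — folklore positivity of the Fejér kernel.
-/

noncomputable section

open Real MeasureTheory intervalIntegral Complex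

namespace Literature.NumberTheory.LFunctions

/-! ### The Fejér-weighted cosine integral `k_L(x) = ∫₀^L (1 − t/L) cos(tx) dt` -/

/-- `k_L(x) = ∫₀^L (1 − t/L) cos(tx) dt`. [folklore] -/
def fejerWeightCos (L x : ℝ) : ℝ := ∫ t in (0 : ℝ)..L, (1 - t / L) * Real.cos (t * x)

/-- `k_L(0) = L/2`. [folklore] -/
theorem fejerWeightCos_zero (L : ℝ) : fejerWeightCos L 0 = L / 2 := by
  unfold fejerWeightCos
  simp only [mul_zero, Real.cos_zero, mul_one]
  rcases eq_or_ne L 0 with rfl | hL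
  · simp
  rw [integral_sub intervalIntegrable_const (intervalIntegrable_id.div_const L),
    intervalIntegral.integral_const, intervalIntegral.integral_div, integral_id]
  simp only [sub_zero, smul_eq_mul, mul_one]
  field_simp
  ring

/-- `k_L(x) = (1 − cos(Lx))/(Lx²)` for `x ≠ 0`, `L ≠ 0` (the antiderivative of `(1 − t/L)cos(tx)`
is `(1 − t/L) sin(tx)/x − cos(tx)/(Lx²)`). [folklore] -/
theorem fejerWeightCos_of_ne_zero {L x : ℝ} (hL : L ≠ 0) (hx : x ≠ 0) :
    fejerWeightCos L x = (1 - Real.cos (L * x)) / (L * x ^ 2) := by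
  unfold fejerWeightCos
  set G : ℝ → ℝ := fun t ↦ (1 - t / L) * (Real.sin (t * x) / x) - Real.cos (t * x) / (L * x ^ 2)
    with hG
  have hderiv : ∀ t : ℝ, HasDerivAt G ((1 - t / L) * Real.cos (t * x)) t := by
    intro t
    have h1 : HasDerivAt (fun t : ℝ ↦ 1 - t / L) (-(1 / L)) t := by
      simpa using ((hasDerivAt_id t).div_const L).const_sub 1
    have h2' : HasDerivAt (fun t : ℝ ↦ Real.sin (t * x)) (Real.cos (t * x) * x) t :=
      (hasDerivAt_mul_const x).sin
    have h2 : HasDerivAt (fun t : ℝ ↦ Real.sin (t * x) / x) (Real.cos (t * x) * x / x) t :=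
      h2'.div_const x
    have h3' : HasDerivAt (fun t : ℝ ↦ Real.cos (t * x)) (-Real.sin (t * x) * x) t :=
      (hasDerivAt_mul_const x).cos
    have h3 : HasDerivAt (fun t : ℝ ↦ Real.cos (t * x) / (L * x ^ 2))
        (-Real.sin (t * x) * x / (L * x ^ 2)) t :=
      h3'.div_const (L * x ^ 2)
    have h := (h1.mul h2).sub h3
    refine h.congr_deriv ?_
    field_simp
    ring
  have hcont : Continuous fun t : ℝ ↦ (1 - t / L) * Real.cos (t * x) := by fun_prop
  rw [integral_eq_sub_of_hasDerivAt (fun t _ ↦ hderiv t) (hcont.intervalIntegrable _ _)]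
  simp only [hG, zero_div, sub_zero, one_mul, zero_mul, Real.sin_zero, Real.cos_zero, div_self hL,
    sub_self, mul_comm L x]
  field_simp
  ring

/-- **`k_L(x) ≥ 0`** for `L > 0` (Fejér positivity: `1 − cos ≥ 0`). [folklore] -/
theorem fejerWeightCos_nonneg {L : ℝ} (hL : 0 < L) (x : ℝ) : 0 ≤ fejerWeightCos L x := by
  rcases eq_or_ne x 0 with rfl | hx
  · rw [fejerWeightCos_zero]; linarith
  · rw [fejerWeightCos_of_ne_zero hL.ne' hx]
    exact div_nonneg (by linarith [Real.cos_le_one (L * x)]) (by positivity)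

/-! ### `|∑ a_n e^{−iλ_n t}|²` for real coefficients -/

/-- For real `a_n`: `|∑_n a_n e^{−iλ_n t}|² = ∑_{m,n} a_m a_n cos(t(λ_m − λ_n))`. [folklore] -/
theorem norm_sq_sum_mul_cexp {ι : Type*} (s : Finset ι) (a lam : ι → ℝ) (t : ℝ) :
    ‖∑ n ∈ s, (a n : ℂ) * Complex.exp (-(t * lam n) * I)‖ ^ 2 =
      ∑ m ∈ s, ∑ n ∈ s, a m * a n * Real.cos (t * (lam m - lam n)) := by
  set c : ι → ℂ := fun n ↦ (a n : ℂ) * Complex.exp (-(t * lam n) * I) with hc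
  have hconj : ∀ n, (starRingEnd ℂ) (c n) = (a n : ℂ) * Complex.exp ((t * lam n) * I) := by
    intro n
    simp only [hc, map_mul, Complex.conj_ofReal, ← Complex.exp_conj, map_neg, Complex.conj_I,
      mul_neg, neg_mul, neg_neg]
  have hsq : (‖∑ n ∈ s, c n‖ ^ 2 : ℝ) = ((∑ m ∈ s, c m) * (starRingEnd ℂ) (∑ n ∈ s, c n)).re := by
    rw [Complex.mul_conj, Complex.ofReal_re, Complex.normSq_eq_norm_sq]
  rw [hsq, map_sum, Finset.sum_mul_sum, Complex.re_sum]
  refine Finset.sum_congr rfl fun m _ ↦ ?_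
  rw [Complex.re_sum]
  refine Finset.sum_congr rfl fun n _ ↦ ?_
  rw [hconj, hc]
  simp only
  have : (a m : ℂ) * Complex.exp (-(t * lam m) * I) * ((a n : ℂ) * Complex.exp (t * lam n * I)) =
      ((a m * a n : ℝ) : ℂ) * Complex.exp ((-(t * (lam m - lam n)) : ℝ) * I) := by
    push_cast
    rw [mul_mul_mul_comm, ← Complex.exp_add]
    congr 1
    ring_nf
  rw [this, Complex.re_ofReal_mul, Complex.exp_ofReal_mul_I_re, Real.cos_neg]

/-! ### The mean-value identity and lower bound -/

/-- **Fejér-weighted mean value**: for real `a_n`, `λ_n` and any `L`,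
`∫₀^L (1 − t/L)|∑ a_n e^{−iλ_n t}|² dt = ∑_{m,n} a_m a_n k_L(λ_m − λ_n)`. [cite: Hilberdink2007, (3)] -/
theorem fejer_meanSquare_eq {ι : Type*} (s : Finset ι) (a lam : ι → ℝ) (L : ℝ) :
    ∫ t in (0 : ℝ)..L, (1 - t / L) * ‖∑ n ∈ s, (a n : ℂ) * Complex.exp (-(t * lam n) * I)‖ ^ 2 =
      ∑ m ∈ s, ∑ n ∈ s, a m * a n * fejerWeightCos L (lam m - lam n) := by
  simp_rw [norm_sq_sum_mul_cexp, Finset.mul_sum]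
  rw [intervalIntegral.integral_finsetSum (fun m _ ↦ ?_)]
  · refine Finset.sum_congr rfl fun m _ ↦ ?_
    rw [intervalIntegral.integral_finsetSum (fun n _ ↦ ?_)]
    · refine Finset.sum_congr rfl fun n _ ↦ ?_
      rw [fejerWeightCos, ← intervalIntegral.integral_const_mul]
      refine intervalIntegral.integral_congr fun t _ ↦ ?_
      ring
    · exact (by fun_prop : Continuous fun t : ℝ ↦
        (1 - t / L) * (a m * a n * Real.cos (t * (lam m - lam n)))).intervalIntegrable _ _
  · exact (continuous_finsetSum _ fun n _ ↦ (by fun_prop : Continuous fun t : ℝ ↦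
      (1 - t / L) * (a m * a n * Real.cos (t * (lam m - lam n))))).intervalIntegrable _ _

/-- **Fejér-weighted mean-value LOWER bound**: for non-negative `a_n`, arbitrary real frequencies
`λ_n` and `L > 0`, `(L/2) ∑_n a_n² ≤ ∫₀^L (1 − t/L)|∑_n a_n e^{−iλ_n t}|² dt` — all off-diagonal terms
`a_m a_n k_L(λ_m − λ_n)` are `≥ 0` and the diagonal ones are `a_n² L/2`.
[cite: Hilberdink2007, (3)] -/
theorem fejer_meanSquare_ge {ι : Type*} (s : Finset ι) {a : ι → ℝ} (ha : ∀ n ∈ s, 0 ≤ a n)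
    (lam : ι → ℝ) {L : ℝ} (hL : 0 < L) :
    L / 2 * ∑ n ∈ s, a n ^ 2 ≤
      ∫ t in (0 : ℝ)..L, (1 - t / L) * ‖∑ n ∈ s, (a n : ℂ) * Complex.exp (-(t * lam n) * I)‖ ^ 2 := by
  classical
  rw [fejer_meanSquare_eq, Finset.mul_sum]
  refine Finset.sum_le_sum fun m hm ↦ ?_
  have hdiag : L / 2 * a m ^ 2 = a m * a m * fejerWeightCos L (lam m - lam m) := by
    rw [sub_self, fejerWeightCos_zero]
    ring
  rw [hdiag]
  exact Finset.single_le_sum (f := fun n ↦ a m * a n * fejerWeightCos L (lam m - lam n))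
    (fun n hn ↦ mul_nonneg (mul_nonneg (ha m hm) (ha n hn)) (fejerWeightCos_nonneg hL _)) hm

end Literature.NumberTheory.LFunctions

end
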